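import Summits.NavierStokesRegularity.NavierStokesRegularity.Theorems.PerpetualPumpAveragedTypeIBlowupChainContinuation
import Mathlib.Analysis.SpecialFunctions.Integrals.Basic

/-!
# Crux `PerpetualPump.AveragedTypeIBlowup` (stmt-NavierStokesRegularity-1835), line `Sketch`:
# the stub `chainLipschitz` — Lipschitz dependence of the Volterra chain on the datum amplitude

T. Tao, *Finite time blowup for an averaged three-dimensional Navier–Stokes equation*, J. Amer.
Math. Soc. **29** (2016), 601–674 = arXiv:1402.0290v3, §4, p. 22 (4.14): pairing the wavelet Duhamel
formula (4.14) with `ψ_{i,n}` gives the exact Volterra chain of the coefficients,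
`Y_{i,n}(t) = A 1_{(i,n)=(i₀,n₀)} k_{i,n}(t) + ∫₀ᵗ k_{i,n}(t-s) quadTerm(Y)_{i,n}(s) ds`, with the heat
kernels of the modes `k_{i,n}(τ) = Re⟨e^{τΔ}ψ_{i,n}, ψ_{i,n}⟩` (continuous, `|k_{i,n}| ≤ 1`).

This file proves the registered stub `stub_chainLipschitz` of the lead's skeleton
`Cruxes/AveragedTypeIBlowup/Lines/Sketch.lean`, verbatim: two continuous solutions `Y`, `Y'` of the
chain on `[0,S)` with data `A`, `A'` at the mode `(i₀,n₀)`, no modes below `n₀`, and weight-`10` size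
`≤ C` on `[0,S']`, `S' < S`, satisfy `(1+ε₀)^{10n}|Y_{i,n}(t) - Y'_{i,n}(t)| ≤ L |A - A'|` on `[0,S']`
with `L = L(ε₀, α, n₀, S', C)` — the continuous dependence on the datum used by the shooting argument
of the line. The argument (`chainLipschitz_of_kernel`, for general continuous kernels `|k| ≤ 1`) is
the Volterra–Gronwall estimate in the exponentially tilted weight: with
`Λ = 2KC (1+ε₀)^{35/2 - 15n₀/2}` (`K = Σ|α|`, the weighted Lipschitz modulus of the drive,
`abs_quadTerm_sub_le_of_weight`) and `M = sup_{i,n,t ≤ S'} e^{-2Λt}(1+ε₀)^{10n}|Y_{i,n}(t) - Y'_{i,n}(t)|`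
(finite, `≤ 2C`), the chain identity and `2Λ∫₀ᵗ e^{2Λs} ds ≤ e^{2Λt}` give
`M ≤ (1+ε₀)^{10n₀}|A - A'| + M/2`, whence `M ≤ 2(1+ε₀)^{10n₀}|A - A'|`.

Nothing here changes a statement of the route; the file lands with `--supports`.

## References

* T. Tao, J. Amer. Math. Soc. 29 (2016), 601–674, arXiv:1402.0290v3, §4 Lemma 4.1, p. 22 (4.14).
  [`Tao2016AveragedNS`]
-/

noncomputable section

-- the summit namespace `…NavierStokesRegularity.NavierStokesRegularity…` is the tree convention
set_option linter.dupNamespace false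

open MeasureTheory Set Filter Topology
open scoped ENNReal
open Literature.Analysis.FluidPDE Literature.Analysis.FluidPDE.Tao2016
open Literature.Analysis.FluidPDE.TaoCascade (quadTerm IsSymmetricCoeff IsCancellingCoeff)
open Literature.Analysis.FluidPDE.TaoCascade (shiftSet)

namespace Summit.NavierStokesRegularity.NavierStokesRegularity.Theorems.PerpetualPumpAveragedTypeIBlowup

variable {ε₀ : ℝ} {m : ℕ}

/-! ### The exponential tilt -/

/-- `2Λ ∫₀ᵗ e^{2Λs} ds = e^{2Λt} - 1 ≤ e^{2Λt}` (all real `Λ`, `t`). [folklore] -/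
theorem two_mul_mul_integral_exp_le (Λ t : ℝ) :
    2 * Λ * ∫ s in (0 : ℝ)..t, Real.exp (2 * Λ * s) ≤ Real.exp (2 * Λ * t) := by
  have h : (2 * Λ) • ∫ s in (0 : ℝ)..t, Real.exp (2 * Λ * s) =
      ∫ u in (2 * Λ * 0)..(2 * Λ * t), Real.exp u :=
    intervalIntegral.smul_integral_comp_mul_left (f := Real.exp) (2 * Λ)
  rw [smul_eq_mul, mul_zero, integral_exp, Real.exp_zero] at h
  linarith

/-! ### Lipschitz dependence on the datum for a general kernel -/

/-- **Lipschitz dependence of weight-bounded solutions of the Volterra chain on the datum, for general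
continuous kernels `|k_{i,n}| ≤ 1`.** Two continuous solutions `Y`, `Y'` of
`Y_{i,n}(t) = A 1_{(i,n)=(i₀,n₀)} k_{i,n}(t) + ∫₀ᵗ k_{i,n}(t-s) quadTerm(Y)_{i,n}(s) ds` on `[0,S)` (data
`A`, `A'`), with no modes below `n₀` and `(1+ε₀)^{10n}`-size `≤ C` on `[0,S'] ⊆ [0,S)`, satisfy
`(1+ε₀)^{10n}|Y_{i,n} - Y'_{i,n}| ≤ L|A - A'|` on `[0,S']`, `L = 2(1+ε₀)^{10n₀} e^{2ΛS'}`,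
`Λ = 2KC(1+ε₀)^{35/2-15n₀/2}`: Gronwall in the tilted weight `e^{-2Λt}` — the tilted weighted supremum
`M` of the difference obeys `M ≤ (1+ε₀)^{10n₀}|A - A'| + M/2` by the weighted Lipschitz bound of the
drive and `2Λ∫₀ᵗe^{2Λs}ds ≤ e^{2Λt}`. [cite: Tao2016AveragedNS, §4 p. 22 (4.14)] -/
theorem chainLipschitz_of_kernel (hε₀ : 0 < ε₀) (α : Fin m → Fin m → Fin m → ℤ × ℤ × ℤ → ℝ)
    (k : Fin m → ℤ → ℝ → ℝ) (hk1 : ∀ i n τ, |k i n τ| ≤ 1) (hkc : ∀ i n, Continuous (k i n))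
    (i₀ : Fin m) (n₀ : ℤ) {S S' : ℝ} (C : ℝ) (hS'0 : 0 ≤ S') (hS'S : S' < S) :
    ∃ L : ℝ, ∀ (A A' : ℝ) (Y Y' : Fin m → ℤ → ℝ → ℝ),
      (∀ i n, ContinuousOn (Y i n) (Ico 0 S)) → (∀ i n t, n < n₀ → Y i n t = 0) →
      (∀ (i : Fin m) (n : ℤ), ∀ t ∈ Ico 0 S,
        Y i n t = (if i = i₀ ∧ n = n₀ then A else 0) * k i n t +
          ∫ s in (0 : ℝ)..t, k i n (t - s) * quadTerm ε₀ α Y i n s) →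
      (∀ i n, ContinuousOn (Y' i n) (Ico 0 S)) → (∀ i n t, n < n₀ → Y' i n t = 0) →
      (∀ (i : Fin m) (n : ℤ), ∀ t ∈ Ico 0 S,
        Y' i n t = (if i = i₀ ∧ n = n₀ then A' else 0) * k i n t +
          ∫ s in (0 : ℝ)..t, k i n (t - s) * quadTerm ε₀ α Y' i n s) →
      (∀ (i : Fin m) (n : ℤ), ∀ t ∈ Icc 0 S', (1 + ε₀) ^ ((10 : ℝ) * n) * |Y i n t| ≤ C) →
      (∀ (i : Fin m) (n : ℤ), ∀ t ∈ Icc 0 S', (1 + ε₀) ^ ((10 : ℝ) * n) * |Y' i n t| ≤ C) →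
      ∀ (i : Fin m) (n : ℤ), ∀ t ∈ Icc 0 S',
        (1 + ε₀) ^ ((10 : ℝ) * n) * |Y i n t - Y' i n t| ≤ L * |A - A'| := by
  have hL0 : 0 < 1 + ε₀ := by linarith
  have hL1 : 1 ≤ 1 + ε₀ := by linarith
  -- constants: `K = Σ|α|` and the Lipschitz modulus `Λ`
  set K : ℝ := ∑ i₃ : Fin m, ∑ i₁ : Fin m, ∑ i₂ : Fin m, ∑ μ ∈ shiftSet, |α i₁ i₂ i₃ μ| with hK
  have hK0 : 0 ≤ K := by positivity
  have hKall : ∀ i : Fin m, (∑ i₁ : Fin m, ∑ i₂ : Fin m, ∑ μ ∈ shiftSet, |α i₁ i₂ i μ|) ≤ K :=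
    fun i => coeffSum_le α i
  clear_value K
  set Λ : ℝ := K * (2 * C) * (1 + ε₀) ^ ((35 : ℝ) / 2 - (15 : ℝ) / 2 * n₀) with hΛ
  clear_value Λ
  refine ⟨2 * (1 + ε₀) ^ ((10 : ℝ) * n₀) * Real.exp (2 * Λ * S'), ?_⟩
  intro A A' Y Y' hYc hY0 hYeq hY'c hY'0 hY'eq hYb hY'b
  have hIccS : Icc 0 S' ⊆ Ico 0 S := fun s hs => ⟨hs.1, hs.2.trans_lt hS'S⟩
  have hC0 : 0 ≤ C :=
    le_trans (mul_nonneg (Real.rpow_nonneg hL0.le _) (abs_nonneg _)) (hYb i₀ n₀ 0 ⟨le_rfl, hS'0⟩)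
  have hΛ0 : 0 ≤ Λ := by rw [hΛ]; positivity
  -- the tilted weighted difference `φ`
  obtain ⟨φ, hφ⟩ : ∃ φ : Fin m → ℤ → ℝ → ℝ, ∀ i n t, φ i n t =
      Real.exp (-(2 * Λ * t)) * ((1 + ε₀) ^ ((10 : ℝ) * n) * |Y i n t - Y' i n t|) :=
    ⟨_, fun _ _ _ => rfl⟩
  have hφ0 : ∀ i n t, 0 ≤ φ i n t := fun i n t => by rw [hφ]; positivity
  have hφC : ∀ i n, ∀ t ∈ Icc 0 S', φ i n t ≤ 2 * C := fun i n t ht => by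
    rw [hφ]
    have h1 : Real.exp (-(2 * Λ * t)) ≤ 1 := Real.exp_le_one_iff.2 (by nlinarith [ht.1])
    have h2 : (1 + ε₀) ^ ((10 : ℝ) * n) * |Y i n t - Y' i n t| ≤ 2 * C := by
      calc (1 + ε₀) ^ ((10 : ℝ) * n) * |Y i n t - Y' i n t|
          ≤ (1 + ε₀) ^ ((10 : ℝ) * n) * (|Y i n t| + |Y' i n t|) :=
            mul_le_mul_of_nonneg_left (abs_sub _ _) (Real.rpow_nonneg hL0.le _)
        _ ≤ C + C := by rw [mul_add]; exact add_le_add (hYb i n t ht) (hY'b i n t ht)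
        _ = 2 * C := by ring
    calc Real.exp (-(2 * Λ * t)) * ((1 + ε₀) ^ ((10 : ℝ) * n) * |Y i n t - Y' i n t|)
        ≤ 1 * (2 * C) := mul_le_mul h1 h2 (by positivity) zero_le_one
      _ = 2 * C := one_mul _
  have hunφ : ∀ (i : Fin m) (n : ℤ) (t : ℝ), (1 + ε₀) ^ ((10 : ℝ) * n) * |Y i n t - Y' i n t| =
      Real.exp (2 * Λ * t) * φ i n t := fun i n t => by
    rw [hφ, ← mul_assoc, ← Real.exp_add, add_neg_cancel, Real.exp_zero, one_mul]
  intro i n t ht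
  -- the tilted weighted supremum `M`
  have hbdd : BddAbove (Set.range fun p : Fin m × ℤ × Icc 0 S' => φ p.1 p.2.1 p.2.2) :=
    ⟨2 * C, by rintro _ ⟨p, rfl⟩; exact hφC _ _ _ p.2.2.2⟩
  set M : ℝ := ⨆ p : Fin m × ℤ × Icc 0 S', φ p.1 p.2.1 p.2.2 with hM
  have hφM : ∀ (j : Fin m) (n' : ℤ), ∀ s ∈ Icc 0 S', φ j n' s ≤ M := fun j n' s hs =>
    le_ciSup hbdd (⟨j, n', ⟨s, hs⟩⟩ : Fin m × ℤ × Icc 0 S')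
  have hM0 : 0 ≤ M := (hφ0 i n t).trans (hφM i n t ht)
  -- weighted bounds at times in `[0,S']`
  have hYw : ∀ s ∈ Icc 0 S', ∀ (j : Fin m) (k' : ℤ), |Y j k' s| ≤ C * (1 + ε₀) ^ (-((10 : ℝ) * k')) :=
    fun s hs j k' => (weight_mul_abs_le_iff hL0 _ _ _).1 (hYb j k' s hs)
  have hY'w : ∀ s ∈ Icc 0 S', ∀ (j : Fin m) (k' : ℤ), |Y' j k' s| ≤ C * (1 + ε₀) ^ (-((10 : ℝ) * k')) :=
    fun s hs j k' => (weight_mul_abs_le_iff hL0 _ _ _).1 (hY'b j k' s hs)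
  have hdw : ∀ s ∈ Icc 0 S', ∀ (j : Fin m) (k' : ℤ),
      |Y j k' s - Y' j k' s| ≤ M * Real.exp (2 * Λ * s) * (1 + ε₀) ^ (-((10 : ℝ) * k')) :=
    fun s hs j k' => (weight_mul_abs_le_iff hL0 _ _ _).1 (by
      rw [hunφ, mul_comm M]
      exact mul_le_mul_of_nonneg_left (hφM j k' s hs) (Real.exp_pos _).le)
  -- the key estimate: `φ ≤ (1+ε₀)^{10n₀}|A - A'| + M/2` on `[0,S']`
  have hkey : ∀ (j : Fin m) (n' : ℤ), ∀ s ∈ Icc 0 S',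
      φ j n' s ≤ (1 + ε₀) ^ ((10 : ℝ) * n₀) * |A - A'| + M / 2 := by
    intro j n' s hs
    rcases lt_or_ge n' n₀ with hn | hn
    · rw [hφ, hY0 j n' s hn, hY'0 j n' s hn, sub_zero, abs_zero, mul_zero, mul_zero]
      positivity
    -- the difference solves the chain with datum `A - A'` and the difference of the drives
    have hInt : ∀ {Z : Fin m → ℤ → ℝ → ℝ}, (∀ a b, ContinuousOn (Z a b) (Ico 0 S)) →
        IntervalIntegrable (fun u => k j n' (s - u) * quadTerm ε₀ α Z j n' u) volume 0 s := fun hZ =>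
      ((((hkc j n').comp (continuous_const.sub continuous_id)).continuousOn).mul
        ((quadTerm_continuousOn α hZ j n').mono (by
          rw [uIcc_of_le hs.1]
          exact fun u hu => hIccS ⟨hu.1, hu.2.trans hs.2⟩))).intervalIntegrable
    have hdiff : Y j n' s - Y' j n' s = (if j = i₀ ∧ n' = n₀ then A - A' else 0) * k j n' s +
        ∫ u in (0 : ℝ)..s, (k j n' (s - u) * quadTerm ε₀ α Y j n' u -
          k j n' (s - u) * quadTerm ε₀ α Y' j n' u) := by
      rw [intervalIntegral.integral_sub (hInt hYc) (hInt hY'c), hYeq j n' s (hIccS hs),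
        hY'eq j n' s (hIccS hs)]
      split_ifs <;> ring
    -- the datum term
    have h1 : (1 + ε₀) ^ ((10 : ℝ) * n') * |(if j = i₀ ∧ n' = n₀ then A - A' else 0) * k j n' s| ≤
        (1 + ε₀) ^ ((10 : ℝ) * n₀) * |A - A'| := by
      split_ifs with h
      · rw [abs_mul, h.2]
        calc (1 + ε₀) ^ ((10 : ℝ) * n₀) * (|A - A'| * |k j n₀ s|)
            ≤ (1 + ε₀) ^ ((10 : ℝ) * n₀) * (|A - A'| * 1) := by
              gcongr
              exact hk1 j n₀ s
          _ = _ := by ring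
      · rw [zero_mul, abs_zero, mul_zero]
        positivity
    -- the Volterra term
    have hexp : (1 + ε₀) ^ ((10 : ℝ) * n') * (1 + ε₀) ^ ((2 * (10 : ℝ) - 5 / 2) * (1 - n')) ≤
        (1 + ε₀) ^ ((35 : ℝ) / 2 - (15 : ℝ) / 2 * n₀) := by
      rw [← Real.rpow_add hL0]
      refine Real.rpow_le_rpow_of_exponent_le hL1 ?_
      have hn'' : (n₀ : ℝ) ≤ n' := by exact_mod_cast hn
      linarith
    have hint := intervalIntegral.norm_integral_le_of_norm_le (μ := volume) hs.1
      (f := fun u => k j n' (s - u) * quadTerm ε₀ α Y j n' u - k j n' (s - u) * quadTerm ε₀ α Y' j n' u)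
      (g := fun u => ((∑ i₁ : Fin m, ∑ i₂ : Fin m, ∑ μ ∈ shiftSet, |α i₁ i₂ j μ|) * (2 * C * M) *
        (1 + ε₀) ^ ((2 * (10 : ℝ) - 5 / 2) * (1 - n'))) * Real.exp (2 * Λ * u))
      (Eventually.of_forall fun u hu => by
        have hu' : u ∈ Icc 0 S' := ⟨hu.1.le, hu.2.trans hs.2⟩
        rw [Real.norm_eq_abs, ← mul_sub, abs_mul]
        calc |k j n' (s - u)| * |quadTerm ε₀ α Y j n' u - quadTerm ε₀ α Y' j n' u|
            ≤ 1 * ((∑ i₁ : Fin m, ∑ i₂ : Fin m, ∑ μ ∈ shiftSet, |α i₁ i₂ j μ|) *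
                (2 * C * (M * Real.exp (2 * Λ * u))) *
                  (1 + ε₀) ^ ((2 * (10 : ℝ) - 5 / 2) * (1 - n'))) :=
              mul_le_mul (hk1 _ _ _) (abs_quadTerm_sub_le_of_weight hε₀ (by norm_num) α hC0
                (by positivity) (hYw u hu') (hY'w u hu') (hdw u hu') j n') (abs_nonneg _) zero_le_one
          _ = _ := by ring)
      ((continuous_const.mul (Real.continuous_exp.comp (continuous_const.mul continuous_id))).intervalIntegrable
        _ _)
    rw [intervalIntegral.integral_const_mul, Real.norm_eq_abs] at hint
    have hI2 := two_mul_mul_integral_exp_le Λ s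
    have hIpos : 0 ≤ ∫ u in (0 : ℝ)..s, Real.exp (2 * Λ * u) :=
      intervalIntegral.integral_nonneg hs.1 fun u _ => (Real.exp_pos _).le
    have h2 : (1 + ε₀) ^ ((10 : ℝ) * n') * |∫ u in (0 : ℝ)..s, (k j n' (s - u) * quadTerm ε₀ α Y j n' u -
        k j n' (s - u) * quadTerm ε₀ α Y' j n' u)| ≤ M / 2 * Real.exp (2 * Λ * s) := by
      calc (1 + ε₀) ^ ((10 : ℝ) * n') * |∫ u in (0 : ℝ)..s, (k j n' (s - u) * quadTerm ε₀ α Y j n' u -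
            k j n' (s - u) * quadTerm ε₀ α Y' j n' u)|
          ≤ (1 + ε₀) ^ ((10 : ℝ) * n') * (((∑ i₁ : Fin m, ∑ i₂ : Fin m, ∑ μ ∈ shiftSet, |α i₁ i₂ j μ|) *
              (2 * C * M) * (1 + ε₀) ^ ((2 * (10 : ℝ) - 5 / 2) * (1 - n'))) *
                ∫ u in (0 : ℝ)..s, Real.exp (2 * Λ * u)) :=
            mul_le_mul_of_nonneg_left hint (Real.rpow_nonneg hL0.le _)
        _ = ((1 + ε₀) ^ ((10 : ℝ) * n') * (1 + ε₀) ^ ((2 * (10 : ℝ) - 5 / 2) * (1 - n'))) *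
              (∑ i₁ : Fin m, ∑ i₂ : Fin m, ∑ μ ∈ shiftSet, |α i₁ i₂ j μ|) * (C * M) *
                (2 * ∫ u in (0 : ℝ)..s, Real.exp (2 * Λ * u)) := by ring
        _ ≤ (1 + ε₀) ^ ((35 : ℝ) / 2 - (15 : ℝ) / 2 * n₀) * K * (C * M) *
              (2 * ∫ u in (0 : ℝ)..s, Real.exp (2 * Λ * u)) := by
            gcongr
            exact hKall j
        _ = M / 2 * (2 * Λ * ∫ u in (0 : ℝ)..s, Real.exp (2 * Λ * u)) := by rw [hΛ]; ring
        _ ≤ M / 2 * Real.exp (2 * Λ * s) := mul_le_mul_of_nonneg_left hI2 (by positivity)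
    have hes : Real.exp (-(2 * Λ * s)) ≤ 1 := Real.exp_le_one_iff.2 (by nlinarith [hs.1])
    rw [hφ, hdiff]
    calc Real.exp (-(2 * Λ * s)) * ((1 + ε₀) ^ ((10 : ℝ) * n') *
          |(if j = i₀ ∧ n' = n₀ then A - A' else 0) * k j n' s +
            ∫ u in (0 : ℝ)..s, (k j n' (s - u) * quadTerm ε₀ α Y j n' u -
              k j n' (s - u) * quadTerm ε₀ α Y' j n' u)|)
        ≤ Real.exp (-(2 * Λ * s)) * ((1 + ε₀) ^ ((10 : ℝ) * n') *
            (|(if j = i₀ ∧ n' = n₀ then A - A' else 0) * k j n' s| +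
              |∫ u in (0 : ℝ)..s, (k j n' (s - u) * quadTerm ε₀ α Y j n' u -
                k j n' (s - u) * quadTerm ε₀ α Y' j n' u)|)) := by
          gcongr
          exact abs_add_le _ _
      _ ≤ Real.exp (-(2 * Λ * s)) * ((1 + ε₀) ^ ((10 : ℝ) * n₀) * |A - A'| +
            M / 2 * Real.exp (2 * Λ * s)) := by
          rw [mul_add]
          exact mul_le_mul_of_nonneg_left (add_le_add h1 h2) (Real.exp_pos _).le
      _ = Real.exp (-(2 * Λ * s)) * ((1 + ε₀) ^ ((10 : ℝ) * n₀) * |A - A'|) + M / 2 := by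
          have hc : Real.exp (-(2 * Λ * s)) * (M / 2 * Real.exp (2 * Λ * s)) = M / 2 := by
            rw [mul_comm (M / 2), ← mul_assoc, ← Real.exp_add, neg_add_cancel, Real.exp_zero, one_mul]
          rw [mul_add, hc]
      _ ≤ 1 * ((1 + ε₀) ^ ((10 : ℝ) * n₀) * |A - A'|) + M / 2 := by gcongr
      _ = _ := by rw [one_mul]
  -- `M ≤ a + M/2`, so `M ≤ 2a`
  haveI : Nonempty (Fin m × ℤ × Icc 0 S') := ⟨⟨i, n, ⟨t, ht⟩⟩⟩
  have hMle : M ≤ (1 + ε₀) ^ ((10 : ℝ) * n₀) * |A - A'| + M / 2 :=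
    ciSup_le fun p => hkey p.1 p.2.1 p.2.2 p.2.2.2
  have hM2 : M ≤ 2 * ((1 + ε₀) ^ ((10 : ℝ) * n₀) * |A - A'|) := by linarith
  have het : Real.exp (2 * Λ * t) ≤ Real.exp (2 * Λ * S') :=
    Real.exp_le_exp.2 (by nlinarith [ht.2])
  calc (1 + ε₀) ^ ((10 : ℝ) * n) * |Y i n t - Y' i n t| = Real.exp (2 * Λ * t) * φ i n t := hunφ i n t
    _ ≤ Real.exp (2 * Λ * S') * (2 * ((1 + ε₀) ^ ((10 : ℝ) * n₀) * |A - A'|)) :=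
        mul_le_mul het ((hφM i n t ht).trans hM2) (hφ0 i n t) (Real.exp_pos _).le
    _ = 2 * (1 + ε₀) ^ ((10 : ℝ) * n₀) * Real.exp (2 * Λ * S') * |A - A'| := by ring

/-! ### The registered stub -/

/-- **Stub `chainLipschitz`** (registered stub of the line `Sketch` of the crux
`PerpetualPump.AveragedTypeIBlowup`, verbatim). Lipschitz dependence on the datum amplitude `A` of
weight-`10`-bounded solutions of the exact Volterra chain of a cascade circuit on compact time intervals:
two continuous chain solutions on `[0,S)` with data `A`, `A'` at the mode `(i₀,n₀)`, no modes below `n₀`,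
and `(1+ε₀)^{10n}|Y_{i,n}| ≤ C` on `[0,S']`, `S' < S`, satisfy
`(1+ε₀)^{10n}|Y_{i,n}(t) - Y'_{i,n}(t)| ≤ L|A - A'|` on `[0,S']` with `L = L(ε₀, α, n₀, S', C)` —
`chainLipschitz_of_kernel` for the heat kernels `k_{i,n}(τ) = Re⟨e^{τΔ}ψ_{i,n}, ψ_{i,n}⟩`, which are
continuous with `|k_{i,n}| ≤ 1`. [cite: Tao2016AveragedNS, §4 p. 22 (4.14)] -/
theorem stub_chainLipschitz :
    ∀ {ε₀ : ℝ}, 0 < ε₀ → ε₀ ≤ 1 → ∀ {m : ℕ} (𝒟 : CascadeWaveletData ε₀ m)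
      (α : Fin m → Fin m → Fin m → ℤ × ℤ × ℤ → ℝ) (i₀ : Fin m) (n₀ : ℤ) (S S' C : ℝ), 0 < S → 0 ≤ S' → S' < S →
      ∃ L : ℝ, ∀ (A A' : ℝ) (Y Y' : Fin m → ℤ → ℝ → ℝ),
      (∀ i n, ContinuousOn (Y i n) (Ico 0 S)) → (∀ i n t, n < n₀ → Y i n t = 0) →
      (∀ (i : Fin m) (n : ℤ), ∀ t ∈ Ico 0 S,
        Y i n t = (if i = i₀ ∧ n = n₀ then A else 0) *
            (pairing (heat t (cascadeWavelet ε₀ (𝒟.ψ i) n)) (cascadeWavelet ε₀ (𝒟.ψ i) n)).re +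
          ∫ s in (0 : ℝ)..t,
            (pairing (heat (t - s) (cascadeWavelet ε₀ (𝒟.ψ i) n)) (cascadeWavelet ε₀ (𝒟.ψ i) n)).re *
              quadTerm ε₀ α Y i n s) →
      (∀ i n, ContinuousOn (Y' i n) (Ico 0 S)) → (∀ i n t, n < n₀ → Y' i n t = 0) →
      (∀ (i : Fin m) (n : ℤ), ∀ t ∈ Ico 0 S,
        Y' i n t = (if i = i₀ ∧ n = n₀ then A' else 0) *
            (pairing (heat t (cascadeWavelet ε₀ (𝒟.ψ i) n)) (cascadeWavelet ε₀ (𝒟.ψ i) n)).re +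
          ∫ s in (0 : ℝ)..t,
            (pairing (heat (t - s) (cascadeWavelet ε₀ (𝒟.ψ i) n)) (cascadeWavelet ε₀ (𝒟.ψ i) n)).re *
              quadTerm ε₀ α Y' i n s) →
      (∀ (i : Fin m) (n : ℤ), ∀ t ∈ Icc 0 S', (1 + ε₀) ^ ((10 : ℝ) * n) * |Y i n t| ≤ C) →
      (∀ (i : Fin m) (n : ℤ), ∀ t ∈ Icc 0 S', (1 + ε₀) ^ ((10 : ℝ) * n) * |Y' i n t| ≤ C) →
      ∀ (i : Fin m) (n : ℤ), ∀ t ∈ Icc 0 S', (1 + ε₀) ^ ((10 : ℝ) * n) * |Y i n t - Y' i n t| ≤ L * |A - A'| := by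
  intro ε₀ hε₀ _hε₁ m 𝒟 α i₀ n₀ S S' C _hS hS'0 hS'S
  exact chainLipschitz_of_kernel hε₀ α
    (fun i n τ => (pairing (heat τ (cascadeWavelet ε₀ (𝒟.ψ i) n)) (cascadeWavelet ε₀ (𝒟.ψ i) n)).re)
    (fun i n τ => abs_re_pairing_heat_cascadeWavelet_le hε₀ 𝒟 i n τ)
    (fun i n => continuous_re_pairing_heat_cascadeWavelet 𝒟 i n) i₀ n₀ C hS'0 hS'S

end Summit.NavierStokesRegularity.NavierStokesRegularity.Theorems.PerpetualPumpAveragedTypeIBlowup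

end
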